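import Literature.AlgebraicGeometry.Motives.AbelianVarietyLatticeTensorHom
import Literature.AlgebraicGeometry.Motives.AbelianVarietyFactorFrobeniusTraces
import HarnessLib

/-!
# `Y ⊗_ℤ M` over a finite field: twisted Frobenius traces `Tr(ρ(g) π^r | T_ℓ(Y ⊗ M)) = tr m(g) · Tr(β(g) π^r | T_ℓ Y)`,
# the Frobenius traces of the factors `|H| · Tr(π^r | T_ℓ B_H(Y ⊗ M)) = (Σ_h tr m(h)) · Tr(π^r | T_ℓ Y)`,
# `|G| · Tr(π^r | T_ℓ B_W(Y ⊗ M)) = (Σ_g c_W(g) tr m(g)) · Tr(π^r | T_ℓ Y)`, and the point counts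
# `#B_W(Y ⊗ M)(𝔽_{q^r}) = #Y(𝔽_{q^r})^{d_W}`, `#B_H(Y ⊗ M)(𝔽_{q^r}) = #Y(𝔽_{q^r})^{rank M^H}`

Sequel of `Motives/AbelianVarietyLatticeTensor{,Hom}` over a FINITE field `K = 𝔽_q`: `X = Y ⊗_ℤ M` is the power `⊕_{i ∈ ι} Y e_i`
(bicone `b`, `Σ_i π_i ≫ ι_i = 𝟙`) with the action `ρ` of `G` through the integral matrix representation `m` and the twist `β`,
`ι_j ≫ ρ(g) ≫ π_i = m(g)_{ij} • β(g)` (`hρ`; untwisted `hρ₁`: `• 𝟙_Y`).  The Frobenius `π` commutes with every homomorphism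
(`frobeniusHom_pow_comp`), so `π_X^r ≫ ρ(g)` has scalar blocks `m(g)_{ij} • (π_Y^r ≫ β(g))` and the prequel's block-trace formula
gives the TWISTED FROBENIUS TRACES of `Y ⊗ M` through those of `Y`:

* §1 **`Tr(T_ℓ ρ(g) ∘ T_ℓ(π_X)^r | T_ℓ(Y ⊗ M)) = tr m(g) · Tr(T_ℓ β(g) ∘ T_ℓ(π_Y)^r | T_ℓ Y)`**
  (`trace_tateModuleMap_asHom_comp_frobeniusHom_pow_eq`), untwisted `= tr m(g) · Tr(T_ℓ(π_Y)^r | T_ℓ Y)` — the `ℓ`-adic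
  representation of `Y ⊗ M` is `T_ℓ(Y) ⊗ M` as a `Gal × G`-module (MRS Thm. 2.2 (iii) "with `γ` acting as `γ⁻¹ ⊗ γ`", here split);
* §2 THE FROBENIUS OF THE FACTORS (untwisted tensor; the tree's `Motives/AbelianVarietyFactorFrobeniusTraces`:
  `|H| Tr(T_ℓ(π_{B_H})^r) = Σ_h τ_r(h)`, `|G| Tr(T_ℓ(π_{B_W})^r) = Σ_g c_W(g) τ_r(g)`):
  **`|H| · Tr(T_ℓ(π_{B_H})^r | T_ℓ B_H(Y ⊗ M)) = (Σ_{h ∈ H} tr m(h)) · Tr(T_ℓ(π_Y)^r | T_ℓ Y)`** and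
  **`|G| · Tr(T_ℓ(π_{B_W})^r | T_ℓ B_W(Y ⊗ M)) = (Σ_g c_W(g) tr m(g)) · Tr(T_ℓ(π_Y)^r | T_ℓ Y)`**, i.e. `Tr(π^r | B_H) = d · Tr(π^r | Y)`,
  `Tr(π^r | B_W) = d_W · Tr(π^r | Y)` for `|H| d = Σ_h tr m(h)`, `|G| d_W = Σ_g c_W(g) tr m(g)` — the factors of `Y ⊗ M` have the
  Frobenius traces of the powers `Y^d`, `Y^{d_W}` ("`L(I ⊗ V, s) = L(V, s)^{rank}`" for a split lattice); the twisted forms with `β`;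
* §3 POINT COUNTS (finite fields are perfect, so the prequel's isogenies `B_W(Y ⊗ M) ∼ Y^{d_W}`, `B_H(Y ⊗ M) ∼ Y^d` apply, and
  isogenous abelian varieties over `𝔽_q` have the same number of points, Tate 1966 Thm. 1 — the tree's `IsIsogenous.pointCount_eq`):
  **`#B_W(Y ⊗ M)(𝔽_{q^r}) = #Y(𝔽_{q^r})^{d_W}`**, **`#B_H(Y ⊗ M)(𝔽_{q^r}) = #Y(𝔽_{q^r})^{d}`**, `#B_G(Y ⊗ M)(𝔽_{q^r}) = #Y(𝔽_{q^r})^{rank M^G}`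
  and the zeta functions `Z(B_W(Y ⊗ M), t) = Z(Y^{d_W}, t)`.

Everything is a theorem; no new definitions.  `π_A` is the tree's `frobeniusHom A`, `#A(𝔽_{q^r})` its `pointCount A.X r`.

## References

* [MazurRubinSilverberg2007] B. Mazur, K. Rubin, A. Silverberg, *Twisting commutative algebraic groups*, J. Algebra 314 (2007),
  Thm. 2.2 (i)–(iii) (`(I ⊗ V)(k^s) ≅ I ⊗ V(k^s)`, `T_ℓ(I ⊗ V) ≅ I ⊗ T_ℓ(V)` Galois-equivariantly), Def. 4.3, Thm. 4.5.  Held, pp. 6, 10 read.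
* [Milne1972ArithmeticAV] J. S. Milne, *On the arithmetic of abelian varieties*, Invent. Math. 17 (1972), §2 Prop. 6 (b) (Tate module of
  `M ⊗ A`), as reported by [MazurRubinSilverberg2007].
* [Tate1966Endomorphisms] J. Tate, *Endomorphisms of abelian varieties over finite fields*, Invent. Math. 2 (1966), §1 Thm. 1
  ((a) ⇔ (c): isogenous ⇔ same zeta function).
* [Milne1986AbelianVarieties] J. S. Milne, *Abelian varieties*, in Cornell–Silverman (1986), §19, proof of Thm. 19.1 (pp. 144–145:
  `π` commutes with all maps; `N_m = deg(1 − π^m)`).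
* [LangeRodriguez2022] H. Lange, R. E. Rodríguez, *Decomposition of Jacobians by Prym Varieties*, LNM 2310 (2022), §2.9.1 Thm. 2.9.1,
  Prop. 2.9.3 (PDF pp. 43, 46).
* [SerreLinearRepresentations1977] J.-P. Serre, *Linear Representations of Finite Groups*, GTM 42, §2.1 Prop. 2 (ii).
* [KaniRosen1989] E. Kani, M. Rosen, *Idempotent relations and factors of Jacobians*, Math. Ann. 284 (1989), §3 Thm. B, Thm. 3.
-/

noncomputable section

open CategoryTheory CategoryTheory.Limits
open Literature.NumberTheory.DiophantineGeometry
open Literature.RepresentationTheory.FiniteGroups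

universe u

namespace Literature.AlgebraicGeometry.Motives

namespace AbelianVariety

namespace LatticeTensor

variable {K : Type u} [Field K] [Finite K]

/-! ## §1 Twisted Frobenius traces of `Y ⊗ M`: `τ_r^X(g) = tr m(g) · τ_r^{Y,β}(g)` -/

section Twisted

variable (ℓ : ℕ) [Fact ℓ.Prime] {Y : AbelianVariety K} {ι : Type} [Fintype ι] [DecidableEq ι] (b : Bicone (fun _ : ι ↦ Y))
  {G : Type} [Group G] (m : G →* Matrix ι ι ℤ) (β : G →* End Y) (ρ : G →* End b.pt)

/-- **`π_X^r ≫ ρ(g)` has scalar blocks `m(g)_{ij} • (π_Y^r ≫ β(g))`** (`π^r` commutes with the injections `ι_j`).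
[cite: Milne1986AbelianVarieties, §19, proof of Thm. 19.1 (p. 144: "`φ ∘ π_W = π_V ∘ φ`")] [cite: MazurRubinSilverberg2007, Thm. 2.2 (iii)] -/
theorem blocks_frobeniusHom_pow_comp_asHom
    (hρ : ∀ (g : G) (i j : ι), b.ι j ≫ End.asHom (ρ g) ≫ b.π i = m g i j • End.asHom (β g)) (g : G) (r : ℕ) (i j : ι) :
    b.ι j ≫ (((End.of (frobeniusHom b.pt) ^ r : End b.pt) : b.pt ⟶ b.pt) ≫ End.asHom (ρ g)) ≫ b.π i =
      m g i j • (((End.of (frobeniusHom Y) ^ r : End Y) : Y ⟶ Y) ≫ End.asHom (β g)) := by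
  simp only [Category.assoc]
  rw [← Category.assoc, ← frobeniusHom_pow_comp (b.ι j) r, Category.assoc, hρ g i j, Preadditive.comp_zsmul]

/-- Untwisted: `π_X^r ≫ ρ(g)` has scalar blocks `m(g)_{ij} • π_Y^r` when `ι_j ρ(g) π_i = m(g)_{ij} • 𝟙`.
[cite: Milne1986AbelianVarieties, §19, proof of Thm. 19.1 (p. 144)] [cite: MazurRubinSilverberg2007, Thm. 2.2 (iii)] -/
theorem blocks_frobeniusHom_pow_comp_asHom_of_blocks_one
    (hρ₁ : ∀ (g : G) (i j : ι), b.ι j ≫ End.asHom (ρ g) ≫ b.π i = m g i j • 𝟙 Y) (g : G) (r : ℕ) (i j : ι) :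
    b.ι j ≫ (((End.of (frobeniusHom b.pt) ^ r : End b.pt) : b.pt ⟶ b.pt) ≫ End.asHom (ρ g)) ≫ b.π i =
      m g i j • ((End.of (frobeniusHom Y) ^ r : End Y) : Y ⟶ Y) := by
  simp only [Category.assoc]
  rw [← Category.assoc, ← frobeniusHom_pow_comp (b.ι j) r, Category.assoc, hρ₁ g i j, Preadditive.comp_zsmul,
    Category.comp_id]
  rfl

/-- **THE TWISTED FROBENIUS TRACES OF `Y ⊗ M`: `Tr(T_ℓ ρ(g) ∘ T_ℓ(π_X)^r | T_ℓ(Y ⊗ M)) = tr m(g) · Tr(T_ℓ β(g) ∘ T_ℓ(π_Y)^r | T_ℓ Y)`**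
(`ℓ ∤ q`, every `r ∈ ℕ`): `T_ℓ(Y ⊗ M) = T_ℓ(Y) ⊗ M` with Frobenius acting on the first factor and `G` on both.
[cite: MazurRubinSilverberg2007, Thm. 2.2 (iii)] [cite: Milne1972ArithmeticAV, §2 Prop. 6 (b)] [cite: SerreLinearRepresentations1977, §2.1 Prop. 2 (ii)]
[cite: Milne1986AbelianVarieties, §19, proof of Thm. 19.1 (pp. 144–145)] -/
theorem trace_tateModuleMap_asHom_comp_frobeniusHom_pow_eq (hb : ∑ j, b.π j ≫ b.ι j = 𝟙 b.pt)
    (hρ : ∀ (g : G) (i j : ι), b.ι j ≫ End.asHom (ρ g) ≫ b.π i = m g i j • End.asHom (β g)) (hℓ : (ℓ : K) ≠ 0)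
    (g : G) (r : ℕ) :
    LinearMap.trace ℤ_[ℓ] (b.pt.tateModule ℓ) (tateModuleMap ℓ (End.asHom (ρ g)) ∘ₗ tateModuleMap ℓ (frobeniusHom b.pt) ^ r) =
      ((m g).trace : ℤ_[ℓ]) *
        LinearMap.trace ℤ_[ℓ] (Y.tateModule ℓ) (tateModuleMap ℓ (End.asHom (β g)) ∘ₗ tateModuleMap ℓ (frobeniusHom Y) ^ r) := by
  have h := trace_tateModuleMap_eq_trace_mul_of_blocks ℓ b hb hℓ (blocks_frobeniusHom_pow_comp_asHom b m β ρ hρ g r)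
  rwa [tateModuleMap_comp, tateModuleMap_end_pow, tateModuleMap_comp, tateModuleMap_end_pow] at h

/-- **Untwisted: `Tr(T_ℓ ρ(g) ∘ T_ℓ(π_X)^r | T_ℓ(Y ⊗ M)) = tr m(g) · Tr(T_ℓ(π_Y)^r | T_ℓ Y)`** — the twisted Frobenius traces of
Milne's `M ⊗ Y` are `tr m(g)` times the Frobenius traces of `Y` (`T_ℓ(M ⊗ Y) ≅ M ⊗ T_ℓ Y` Galois-equivariantly).
[cite: MazurRubinSilverberg2007, Thm. 2.2 (iii)] [cite: Milne1972ArithmeticAV, §2 Prop. 6 (b)] [cite: Milne1986AbelianVarieties, §19, proof of Thm. 19.1 (pp. 144–145)] -/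
theorem trace_tateModuleMap_asHom_comp_frobeniusHom_pow_eq_trace_mul (hb : ∑ j, b.π j ≫ b.ι j = 𝟙 b.pt)
    (hρ₁ : ∀ (g : G) (i j : ι), b.ι j ≫ End.asHom (ρ g) ≫ b.π i = m g i j • 𝟙 Y) (hℓ : (ℓ : K) ≠ 0) (g : G) (r : ℕ) :
    LinearMap.trace ℤ_[ℓ] (b.pt.tateModule ℓ) (tateModuleMap ℓ (End.asHom (ρ g)) ∘ₗ tateModuleMap ℓ (frobeniusHom b.pt) ^ r) =
      ((m g).trace : ℤ_[ℓ]) * LinearMap.trace ℤ_[ℓ] (Y.tateModule ℓ) (tateModuleMap ℓ (frobeniusHom Y) ^ r) := by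
  have h := trace_tateModuleMap_eq_trace_mul_of_blocks ℓ b hb hℓ
    (blocks_frobeniusHom_pow_comp_asHom_of_blocks_one b m ρ hρ₁ g r)
  rwa [tateModuleMap_comp, tateModuleMap_end_pow, tateModuleMap_end_pow] at h

end Twisted

/-! ## §2 The Frobenius traces of `B_H(Y ⊗ M)` and `B_W(Y ⊗ M)` are those of `Y^d`, `Y^{d_W}` -/

section Factors

variable (ℓ : ℕ) [Fact ℓ.Prime] {Y : AbelianVariety K} {ι : Type} [Fintype ι] [DecidableEq ι] (b : Bicone (fun _ : ι ↦ Y))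
  {G : Type} [Group G] (m : G →* Matrix ι ι ℤ) (β : G →* End Y) (ρ : G →* End b.pt)

/-- **`|H| · Tr(T_ℓ(π_{B_H})^r | T_ℓ B_H(Y ⊗_β M)) = Σ_{h ∈ H} tr m(h) · Tr(T_ℓ β(h) ∘ T_ℓ(π_Y)^r | T_ℓ Y)`** for the factor `B_H = Im N_H`,
`N_H = Σ_{h ∈ H} ρ(h)`, of the twisted tensor (`H` a finite subgroup, `ℓ ∤ q`). [cite: LangeRodriguez2022, §2.9.1 Prop. 2.9.3 (PDF p. 46)]
[cite: MazurRubinSilverberg2007, Thm. 2.2 (iii)] [cite: KaniRosen1989, §3 Thm. B] -/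
theorem card_mul_trace_frobeniusHom_pow_image_norm_eq_sum_trace_mul {H : Subgroup G} [Fintype H]
    (hb : ∑ j, b.π j ≫ b.ι j = 𝟙 b.pt)
    (hρ : ∀ (g : G) (i j : ι), b.ι j ≫ End.asHom (ρ g) ≫ b.π i = m g i j • End.asHom (β g)) (hℓ : (ℓ : K) ≠ 0)
    {N : b.pt ⟶ b.pt} (hN : End.of N = ∑ h : H, ρ h) (r : ℕ) :
    (Fintype.card H : ℤ_[ℓ]) * LinearMap.trace ℤ_[ℓ] ((image N).tateModule ℓ) (tateModuleMap ℓ (frobeniusHom (image N)) ^ r) =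
      ∑ h : H, ((m h).trace : ℤ_[ℓ]) *
        LinearMap.trace ℤ_[ℓ] (Y.tateModule ℓ) (tateModuleMap ℓ (End.asHom (β h)) ∘ₗ tateModuleMap ℓ (frobeniusHom Y) ^ r) := by
  rw [card_mul_trace_frobeniusHom_pow_image_norm_eq_sum ℓ ρ hN hℓ r]
  exact Finset.sum_congr rfl fun h _ ↦ trace_tateModuleMap_asHom_comp_frobeniusHom_pow_eq ℓ b m β ρ hb hρ hℓ (h : G) r

/-- **`|H| · Tr(T_ℓ(π_{B_H})^r | T_ℓ B_H(Y ⊗ M)) = (Σ_{h ∈ H} tr m(h)) · Tr(T_ℓ(π_Y)^r | T_ℓ Y)`** for the untwisted tensor: the Frobenius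
traces of the fixed factor are `rank(M^H)` times those of `Y` (`B_H(Y ⊗ M) = Y ⊗ M^H` up to isogeny, `L(B_H, s) = L(Y, s)^{rank M^H}`).
[cite: MazurRubinSilverberg2007, Thm. 2.2 (iii) and Thm. 2.1 (i)] [cite: LangeRodriguez2022, §2.9.1 Prop. 2.9.3 (PDF p. 46)]
[cite: Milne1986AbelianVarieties, §19, proof of Thm. 19.1 (pp. 144–145)] -/
theorem card_mul_trace_frobeniusHom_pow_image_norm_eq {H : Subgroup G} [Fintype H] (hb : ∑ j, b.π j ≫ b.ι j = 𝟙 b.pt)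
    (hρ₁ : ∀ (g : G) (i j : ι), b.ι j ≫ End.asHom (ρ g) ≫ b.π i = m g i j • 𝟙 Y) (hℓ : (ℓ : K) ≠ 0)
    {N : b.pt ⟶ b.pt} (hN : End.of N = ∑ h : H, ρ h) (r : ℕ) :
    (Fintype.card H : ℤ_[ℓ]) * LinearMap.trace ℤ_[ℓ] ((image N).tateModule ℓ) (tateModuleMap ℓ (frobeniusHom (image N)) ^ r) =
      (∑ h : H, ((m h).trace : ℤ_[ℓ])) * LinearMap.trace ℤ_[ℓ] (Y.tateModule ℓ) (tateModuleMap ℓ (frobeniusHom Y) ^ r) := by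
  rw [card_mul_trace_frobeniusHom_pow_image_norm_eq_sum ℓ ρ hN hℓ r, Finset.sum_mul]
  exact Finset.sum_congr rfl fun h _ ↦
    trace_tateModuleMap_asHom_comp_frobeniusHom_pow_eq_trace_mul ℓ b m ρ hb hρ₁ hℓ (h : G) r

/-- **`Tr(T_ℓ(π_{B_H})^r | T_ℓ B_H(Y ⊗ M)) = d · Tr(T_ℓ(π_Y)^r | T_ℓ Y)` whenever `|H| · d = Σ_{h ∈ H} tr m(h)`** (`d = rank M^H`):
the fixed factor has the Frobenius traces of `Y^d` for every `r`. [cite: MazurRubinSilverberg2007, Thm. 2.1 (i), (iii) and Thm. 2.2 (iii)]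
[cite: Tate1966Endomorphisms, §1 Thm. 1] [cite: LangeRodriguez2022, §2.9.1 Prop. 2.9.3 (PDF p. 46)] -/
theorem trace_frobeniusHom_pow_image_norm_eq_of_card_mul_eq {H : Subgroup G} [Fintype H] (hb : ∑ j, b.π j ≫ b.ι j = 𝟙 b.pt)
    (hρ₁ : ∀ (g : G) (i j : ι), b.ι j ≫ End.asHom (ρ g) ≫ b.π i = m g i j • 𝟙 Y) (hℓ : (ℓ : K) ≠ 0)
    {N : b.pt ⟶ b.pt} (hN : End.of N = ∑ h : H, ρ h) {d : ℕ} (hd : (Fintype.card H : ℤ) * d = ∑ h : H, (m h).trace)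
    (r : ℕ) :
    LinearMap.trace ℤ_[ℓ] ((image N).tateModule ℓ) (tateModuleMap ℓ (frobeniusHom (image N)) ^ r) =
      (d : ℤ_[ℓ]) * LinearMap.trace ℤ_[ℓ] (Y.tateModule ℓ) (tateModuleMap ℓ (frobeniusHom Y) ^ r) := by
  have h := card_mul_trace_frobeniusHom_pow_image_norm_eq ℓ b m ρ hb hρ₁ hℓ hN r
  have hd' : (∑ h : H, ((m h).trace : ℤ_[ℓ])) = (Fintype.card H : ℤ_[ℓ]) * d := by
    rw [← Int.cast_sum, ← hd]
    push_cast
    ring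
  rw [hd', mul_assoc] at h
  exact mul_left_cancel₀ (Nat.cast_ne_zero.2 Fintype.card_ne_zero) h

variable [Fintype G] {c : ratCharIdempotents G → G → ℤ}
  (hc : ∀ e : ratCharIdempotents G,
    (Fintype.card G : ℚ) • (e : MonoidAlgebra ℚ G) = ∑ g, (c e g : ℚ) • MonoidAlgebra.of ℚ G g)
  {u : ratCharIdempotents G → (b.pt ⟶ b.pt)} (hu : ∀ e, End.of (u e) = ∑ g, c e g • ρ g)

include hc hu

/-- **`|G| · Tr(T_ℓ(π_{B_W})^r | T_ℓ B_W(Y ⊗_β M)) = Σ_g c_W(g) · tr m(g) · Tr(T_ℓ β(g) ∘ T_ℓ(π_Y)^r | T_ℓ Y)`** for every isotypical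
component `B_W = Im u_W`, `u_W = Σ_g c_W(g) ρ(g)`, of the twisted tensor (`ℓ ∤ q`). [cite: LangeRodriguez2022, §2.9.1 Thm. 2.9.1 and Prop. 2.9.3 (PDF pp. 43, 46)]
[cite: MazurRubinSilverberg2007, Thm. 2.2 (iii) and Thm. 4.5] -/
theorem card_mul_trace_frobeniusHom_pow_isotypical_eq_sum_trace_mul (hb : ∑ j, b.π j ≫ b.ι j = 𝟙 b.pt)
    (hρ : ∀ (g : G) (i j : ι), b.ι j ≫ End.asHom (ρ g) ≫ b.π i = m g i j • End.asHom (β g)) (hℓ : (ℓ : K) ≠ 0)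
    (e : ratCharIdempotents G) (r : ℕ) :
    (Fintype.card G : ℤ_[ℓ]) *
        LinearMap.trace ℤ_[ℓ] ((image (u e)).tateModule ℓ) (tateModuleMap ℓ (frobeniusHom (image (u e))) ^ r) =
      ∑ g, (c e g : ℤ_[ℓ]) * (((m g).trace : ℤ_[ℓ]) *
        LinearMap.trace ℤ_[ℓ] (Y.tateModule ℓ) (tateModuleMap ℓ (End.asHom (β g)) ∘ₗ tateModuleMap ℓ (frobeniusHom Y) ^ r)) := by
  rw [card_mul_trace_frobeniusHom_pow_isotypical_eq_sum ℓ ρ hc hu hℓ e r]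
  exact Finset.sum_congr rfl fun g _ ↦ by
    rw [trace_tateModuleMap_asHom_comp_frobeniusHom_pow_eq ℓ b m β ρ hb hρ hℓ g r]

/-- **`|G| · Tr(T_ℓ(π_{B_W})^r | T_ℓ B_W(Y ⊗ M)) = (Σ_g c_W(g) tr m(g)) · Tr(T_ℓ(π_Y)^r | T_ℓ Y)`** for the untwisted tensor: the
isotypical component `B_W(Y ⊗ M) = Y ⊗ M_W` has `d_W = dim_ℚ e_W M_ℚ` times the Frobenius traces of `Y` ("`Res V ∼ ⊕_ρ V_ρ`" with
`V_ρ = I_ρ ⊗ V` of Frobenius traces `rank I_ρ · Tr`). [cite: MazurRubinSilverberg2007, Thm. 2.2 (iii), Def. 4.3 and Thm. 4.5]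
[cite: LangeRodriguez2022, §2.9.1 Thm. 2.9.1 and Prop. 2.9.3 (PDF pp. 43, 46)] [cite: Milne1986AbelianVarieties, §19, proof of Thm. 19.1 (pp. 144–145)] -/
theorem card_mul_trace_frobeniusHom_pow_isotypical_eq (hb : ∑ j, b.π j ≫ b.ι j = 𝟙 b.pt)
    (hρ₁ : ∀ (g : G) (i j : ι), b.ι j ≫ End.asHom (ρ g) ≫ b.π i = m g i j • 𝟙 Y) (hℓ : (ℓ : K) ≠ 0)
    (e : ratCharIdempotents G) (r : ℕ) :
    (Fintype.card G : ℤ_[ℓ]) *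
        LinearMap.trace ℤ_[ℓ] ((image (u e)).tateModule ℓ) (tateModuleMap ℓ (frobeniusHom (image (u e))) ^ r) =
      (∑ g, ((c e g * (m g).trace : ℤ) : ℤ_[ℓ])) * LinearMap.trace ℤ_[ℓ] (Y.tateModule ℓ) (tateModuleMap ℓ (frobeniusHom Y) ^ r) := by
  rw [card_mul_trace_frobeniusHom_pow_isotypical_eq_sum ℓ ρ hc hu hℓ e r, Finset.sum_mul]
  refine Finset.sum_congr rfl fun g _ ↦ ?_
  rw [trace_tateModuleMap_asHom_comp_frobeniusHom_pow_eq_trace_mul ℓ b m ρ hb hρ₁ hℓ g r, Int.cast_mul, mul_assoc]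

/-- **`Tr(T_ℓ(π_{B_W})^r | T_ℓ B_W(Y ⊗ M)) = d · Tr(T_ℓ(π_Y)^r | T_ℓ Y)` whenever `|G| · d = Σ_g c_W(g) tr m(g)`** (`d = dim_ℚ e_W M_ℚ`): the
isotypical component has the Frobenius traces of `Y^d` for every `r`. [cite: MazurRubinSilverberg2007, Thm. 2.2 (iii), Def. 4.3 and Thm. 4.5]
[cite: Tate1966Endomorphisms, §1 Thm. 1] [cite: LangeRodriguez2022, §2.9.1 Prop. 2.9.3 (PDF p. 46)] -/
theorem trace_frobeniusHom_pow_isotypical_eq_of_card_mul_eq (hb : ∑ j, b.π j ≫ b.ι j = 𝟙 b.pt)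
    (hρ₁ : ∀ (g : G) (i j : ι), b.ι j ≫ End.asHom (ρ g) ≫ b.π i = m g i j • 𝟙 Y) (hℓ : (ℓ : K) ≠ 0)
    (e : ratCharIdempotents G) {d : ℕ} (hd : (Fintype.card G : ℤ) * d = ∑ g, c e g * (m g).trace) (r : ℕ) :
    LinearMap.trace ℤ_[ℓ] ((image (u e)).tateModule ℓ) (tateModuleMap ℓ (frobeniusHom (image (u e))) ^ r) =
      (d : ℤ_[ℓ]) * LinearMap.trace ℤ_[ℓ] (Y.tateModule ℓ) (tateModuleMap ℓ (frobeniusHom Y) ^ r) := by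
  have h := card_mul_trace_frobeniusHom_pow_isotypical_eq ℓ b m ρ hc hu hb hρ₁ hℓ e r
  have hd' : (∑ g, ((c e g * (m g).trace : ℤ) : ℤ_[ℓ])) = (Fintype.card G : ℤ_[ℓ]) * d := by
    rw [← Int.cast_sum, ← hd]
    push_cast
    ring
  rw [hd', mul_assoc] at h
  exact mul_left_cancel₀ (Nat.cast_ne_zero.2 Fintype.card_ne_zero) h

end Factors

/-! ## §3 Point counts: `#B_W(Y ⊗ M)(𝔽_{q^r}) = #Y(𝔽_{q^r})^{d_W}`, `#B_H(Y ⊗ M)(𝔽_{q^r}) = #Y(𝔽_{q^r})^d` -/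

section PointCounts

variable {Y : AbelianVariety K} {ι : Type} [Fintype ι] [DecidableEq ι] (b : Bicone (fun _ : ι ↦ Y))
  {G : Type} [Group G] (m : G →* Matrix ι ι ℤ) (ρ : G →* End b.pt)

/-- **`#B_H(Y ⊗ M)(𝔽_{q^r}) = #Y(𝔽_{q^r})^d` whenever `|H| · d = Σ_{h ∈ H} tr m(h)`** (`d = rank M^H`, `r ≥ 1`): a finite field is
perfect, so `B_H(Y ⊗ M) ∼ Y^d` (the prequel's `isIsogenous_image_norm_biproduct`), and isogenous abelian varieties over `𝔽_q` have
the same number of points (Tate). [cite: Tate1966Endomorphisms, §1 Thm. 1] [cite: MazurRubinSilverberg2007, Thm. 2.1 (iii) and Thm. 2.2 (i)]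
[cite: Milne1986AbelianVarieties, §19, proof of Thm. 19.1 (p. 145)] [cite: KaniRosen1989, §3 Thm. B] -/
theorem pointCount_image_norm_eq_pow {H : Subgroup G} [Fintype H] (hb : ∑ j, b.π j ≫ b.ι j = 𝟙 b.pt)
    (hρ₁ : ∀ (g : G) (i j : ι), b.ι j ≫ End.asHom (ρ g) ≫ b.π i = m g i j • 𝟙 Y)
    {N : b.pt ⟶ b.pt} (hN : End.of N = ∑ h : H, ρ h) {d : ℕ} (hd : (Fintype.card H : ℤ) * d = ∑ h : H, (m h).trace)
    {r : ℕ} (hr : 0 < r) : pointCount (image N).X r = pointCount Y.X r ^ d := by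
  rw [(isIsogenous_image_norm_biproduct b m ρ hb hρ₁ hN hd).pointCount_eq hr, pointCount_biproduct_const Y hr,
    Fintype.card_fin]

/-- **`#B_G(Y ⊗ M)(𝔽_{q^r}) = #Y(𝔽_{q^r})^d` whenever `|G| · d = Σ_g tr m(g)`** (`d = rank M^G`, `G` finite, `r ≥ 1`).
[cite: Tate1966Endomorphisms, §1 Thm. 1] [cite: MazurRubinSilverberg2007, Thm. 2.1 (iii) and Thm. 2.2 (i)] [cite: KaniRosen1989, §3 Thm. B] -/
theorem pointCount_image_normG_eq_pow [Fintype G] (hb : ∑ j, b.π j ≫ b.ι j = 𝟙 b.pt)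
    (hρ₁ : ∀ (g : G) (i j : ι), b.ι j ≫ End.asHom (ρ g) ≫ b.π i = m g i j • 𝟙 Y)
    {NG : b.pt ⟶ b.pt} (hNG : End.of NG = ∑ g, ρ g) {d : ℕ} (hd : (Fintype.card G : ℤ) * d = ∑ g, (m g).trace)
    {r : ℕ} (hr : 0 < r) : pointCount (image NG).X r = pointCount Y.X r ^ d := by
  rw [(isIsogenous_image_normG_biproduct b m ρ hb hρ₁ hNG hd).pointCount_eq hr, pointCount_biproduct_const Y hr,
    Fintype.card_fin]

variable [Fintype G] {c : ratCharIdempotents G → G → ℤ}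
  (hc : ∀ e : ratCharIdempotents G,
    (Fintype.card G : ℚ) • (e : MonoidAlgebra ℚ G) = ∑ g, (c e g : ℚ) • MonoidAlgebra.of ℚ G g)
  {u : ratCharIdempotents G → (b.pt ⟶ b.pt)} (hu : ∀ e, End.of (u e) = ∑ g, c e g • ρ g)

include hc hu

/-- **`#B_W(Y ⊗ M)(𝔽_{q^r}) = #Y(𝔽_{q^r})^{d_W}` whenever `|G| · d_W = Σ_g c_W(g) tr m(g)`** (`d_W = dim_ℚ e_W M_ℚ`, `r ≥ 1`): the
isotypical component `Y ⊗ M_W` of Milne's `M ⊗ Y` counts points like `Y^{d_W}` (`B_W(Y ⊗ M) ∼ Y^{d_W}` over the perfect field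
`𝔽_q`, and Tate's theorem). [cite: Tate1966Endomorphisms, §1 Thm. 1] [cite: MazurRubinSilverberg2007, Thm. 2.2 (i), Def. 4.3 and Thm. 4.5]
[cite: LangeRodriguez2022, §2.9.1 Thm. 2.9.1 and Prop. 2.9.3 (PDF pp. 43, 46)] -/
theorem pointCount_isotypical_eq_pow (hb : ∑ j, b.π j ≫ b.ι j = 𝟙 b.pt)
    (hρ₁ : ∀ (g : G) (i j : ι), b.ι j ≫ End.asHom (ρ g) ≫ b.π i = m g i j • 𝟙 Y) (e : ratCharIdempotents G)
    {d : ℕ} (hd : (Fintype.card G : ℤ) * d = ∑ g, c e g * (m g).trace) {r : ℕ} (hr : 0 < r) :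
    pointCount (image (u e)).X r = pointCount Y.X r ^ d := by
  rw [(isIsogenous_isotypical_biproduct b m ρ hc hu hb hρ₁ e hd).pointCount_eq hr, pointCount_biproduct_const Y hr,
    Fintype.card_fin]

/-- **`Z(B_W(Y ⊗ M), t) = Z(Y^{d_W}, t)`**: the isotypical component and the power `Y^{d_W} = ⨁_{Fin d_W} Y` have the same zeta function
(`|G| d_W = Σ_g c_W(g) tr m(g)`). [cite: Tate1966Endomorphisms, §1 Thm. 1] [cite: MazurRubinSilverberg2007, Def. 4.3 and Thm. 4.5] -/
theorem zetaSeries_isotypical_eq (hb : ∑ j, b.π j ≫ b.ι j = 𝟙 b.pt)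
    (hρ₁ : ∀ (g : G) (i j : ι), b.ι j ≫ End.asHom (ρ g) ≫ b.π i = m g i j • 𝟙 Y) (e : ratCharIdempotents G)
    {d : ℕ} (hd : (Fintype.card G : ℤ) * d = ∑ g, c e g * (m g).trace) :
    zetaSeries (image (u e)).X = zetaSeries (⨁ fun _ : Fin d ↦ Y).X :=
  (isIsogenous_isotypical_biproduct b m ρ hc hu hb hρ₁ e hd).zetaSeries_eq

/-- **`#(Y ⊗ M)(𝔽_{q^r}) = ∏_W #Y(𝔽_{q^r})^{d_W}`** (`|G| d_W = Σ_g c_W(g) tr m(g)`, `r ≥ 1`) — the point count of `Y ⊗ M` split along the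
isotypical decomposition `Y ⊗ M ∼ ∏_W Y^{d_W}` (`Σ_W d_W = rank M`). [cite: Tate1966Endomorphisms, §1 Thm. 1]
[cite: MazurRubinSilverberg2007, Thm. 4.5 and Cor. 2.5] [cite: LangeRodriguez2022, §2.9.1 Thm. 2.9.1 (b) (PDF p. 43)] -/
theorem pointCount_eq_prod_pow (hb : ∑ j, b.π j ≫ b.ι j = 𝟙 b.pt)
    (hρ₁ : ∀ (g : G) (i j : ι), b.ι j ≫ End.asHom (ρ g) ≫ b.π i = m g i j • 𝟙 Y) {d : ratCharIdempotents G → ℕ}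
    (hd : ∀ e, (Fintype.card G : ℤ) * d e = ∑ g, c e g * (m g).trace) {r : ℕ} (hr : 0 < r) :
    pointCount b.pt.X r = ∏ e, pointCount Y.X r ^ d e := by
  rw [(isIsogenous_biproduct_biproduct b m ρ hc hu hb hρ₁ hd).pointCount_eq hr, pointCount_biproduct _ hr]
  exact Finset.prod_congr rfl fun e _ ↦ by rw [pointCount_biproduct_const Y hr, Fintype.card_fin]

end PointCounts

end LatticeTensor

end AbelianVariety

end Literature.AlgebraicGeometry.Motives
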